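import Literature.MathematicalPhysics.QuantumFieldTheory.QCD
import Literature.MathematicalPhysics.QuantumLattice.OverlapLocality
import Literature.MathematicalPhysics.QuantumLattice.GaugeGroups
import Summits.QuantumFields.QCD.Theorems.NestedDissectionSeaKineticEdgeDiamagnetic
import Summits.QuantumFields.QCD.Theorems.HeatSlicedQuarksAccretiveWilsonDirac

/-!
# Crux `EarlyCrosserLaw` (stmt-QuantumFields-13995), line `cells-inherit-torus-extinction`:
# the lattice Weitzenböck (curvature) bound for the `r = 1` Wilson–Dirac operator

Stubs `plaquetteDefect_le_quadForm` and `plaquetteDefect_le_of_realEigenvalue` of the crux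
`Summit.QuantumFields.QCD.Theses.NestedDissectionSea.EarlyCrosserLaw`.

For a gauge field `U` on the four-torus `(ℤ/L)⁴` read through a unitary representation `ρ`
(here: `SU(3)` in the fundamental representation) and a fermion field `v` on site × colour × spin,
write `D(y,κ) = v(y,·,α) − ρ(U(y,κ)) v(y+κ̂,·,α)` for the covariant link defects (fixed spin `α`)
and `U_□ = U(x,μ) U(x+μ̂,ν) U(x+ν̂,μ)⁻¹ U(x,ν)⁻¹` for the plaquette holonomy (`plaquetteHolonomy`).

* `holonomy_defect_telescope` / `holonomy_defect_sq_le` — ONE PLAQUETTE: telescoping the holonomy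
  defect along the four links,
  `v(x) − ρ(U_□) v(x) = D₁ + ρ(U₁) D₂ − ρ(U₁U₂U₃⁻¹) D₃ − ρ(U_□) D₄`, and unitarity of `ρ` give
  `|v(x) − ρ(U_□)v(x)|² ≤ 4 (|D(x,μ)|² + |D(x+μ̂,ν)|² + |D(x+ν̂,μ)|² + |D(x,ν)|²)`;
* the KINETIC IDENTITY `Re⟨v, D_W(U,0,1) v⟩ = ½ Σ_{y,κ,α} |D(y,κ)|²` is the tree's
  `re_quadForm_wilsonDirac_eq_wilsonTerm` (Wilson-term accretivity, file
  `HeatSlicedQuarksAccretiveWilsonDirac`);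
* `plaquetteDefect_le_quadForm_of_unitary` — summing the one-plaquette bound over sites, ordered
  pairs `μ ≠ ν` (the `μ = ν` holonomy is trivial) and spins, each link defect is met `12` times
  after re-indexing the site sums by torus translations:
  `Σ_{x,μ,ν,α} |v(x) − ρ(U_□)v(x)|² ≤ 48 Σ_{y,κ,α} |D(y,κ)|² = 96 Re⟨v, D_W(U,0,1) v⟩`;
* `plaquetteDefect_le_quadForm`, `plaquetteDefect_le_of_realEigenvalue` — the `SU(3)` statements
  registered on the crux: an early real mode `D_W v = λ v` sees every plaquette on its support
  trivial to precision `96 λ ‖v‖²`.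

Standard material (lattice Weitzenböck / Lichnerowicz bookkeeping); Mathlib and the tree only, no
definitions, no named facts. [folklore]
-/

noncomputable section

open Matrix Complex
open scoped Kronecker ComplexConjugate BigOperators
open Literature.MathematicalPhysics.QuantumLattice Literature.MathematicalPhysics.QuantumFieldTheory
  Literature.Probability.LatticeModels
open Summit.QuantumFields.QCD.Theorems.KineticEdge (sum_norm_sq_mulVec_of_isometry)
open Summit.QuantumFields.QCD.Theorems.HeatSlicedQuarksAccretiveWilsonDirac
  (re_quadForm_wilsonDirac_eq_wilsonTerm)

namespace Summit.QuantumFields.QCD.Cruxes.EarlyCrosserLaw.CurvatureBound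

/-! ### Scalar and vector bookkeeping -/

/-- `|a + b + c + d|² ≤ 4 (|a|² + |b|² + |c|² + |d|²)` for complex numbers (Cauchy–Schwarz with the
constant vector). [folklore] -/
theorem norm_add_four_sq_le (a b c d : ℂ) :
    ‖a + b + c + d‖ ^ 2 ≤ 4 * (‖a‖ ^ 2 + ‖b‖ ^ 2 + ‖c‖ ^ 2 + ‖d‖ ^ 2) := by
  have h1 := norm_add_le (a + b + c) d
  have h2 := norm_add_le (a + b) c
  have h3 := norm_add_le a b
  have hs : ‖a + b + c + d‖ ≤ ‖a‖ + ‖b‖ + ‖c‖ + ‖d‖ := by linarith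
  calc ‖a + b + c + d‖ ^ 2 ≤ (‖a‖ + ‖b‖ + ‖c‖ + ‖d‖) ^ 2 :=
        pow_le_pow_left₀ (norm_nonneg _) hs 2
    _ ≤ 4 * (‖a‖ ^ 2 + ‖b‖ ^ 2 + ‖c‖ ^ 2 + ‖d‖ ^ 2) := by
        nlinarith [sq_nonneg (‖a‖ - ‖b‖), sq_nonneg (‖a‖ - ‖c‖), sq_nonneg (‖a‖ - ‖d‖),
          sq_nonneg (‖b‖ - ‖c‖), sq_nonneg (‖b‖ - ‖d‖), sq_nonneg (‖c‖ - ‖d‖)]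

section Generic

variable {n : Type*} [Fintype n]

/-- Vector form of `norm_add_four_sq_le`:
`Σ_a |(u₁ + u₂ + u₃ + u₄)(a)|² ≤ 4 (Σ_a |u₁ a|² + Σ_a |u₂ a|² + Σ_a |u₃ a|² + Σ_a |u₄ a|²)`.
[folklore] -/
theorem sum_norm_sq_add_four_le (u₁ u₂ u₃ u₄ : n → ℂ) :
    ∑ a, ‖(u₁ + u₂ + u₃ + u₄) a‖ ^ 2 ≤
      4 * (∑ a, ‖u₁ a‖ ^ 2 + ∑ a, ‖u₂ a‖ ^ 2 + ∑ a, ‖u₃ a‖ ^ 2 + ∑ a, ‖u₄ a‖ ^ 2) := by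
  have h : ∀ a ∈ Finset.univ, ‖(u₁ + u₂ + u₃ + u₄) a‖ ^ 2 ≤
      4 * (‖u₁ a‖ ^ 2 + ‖u₂ a‖ ^ 2 + ‖u₃ a‖ ^ 2 + ‖u₄ a‖ ^ 2) := fun a _ => by
    simp only [Pi.add_apply]
    exact norm_add_four_sq_le _ _ _ _
  refine (Finset.sum_le_sum h).trans_eq ?_
  rw [← Finset.mul_sum, Finset.sum_add_distrib, Finset.sum_add_distrib, Finset.sum_add_distrib]

end Generic

/-! ### One plaquette: telescoping the holonomy defect along the four links -/

section Plaquette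

variable {G : Type*} [Group G] {N : ℕ} (ρ : G →* Matrix (Fin N) (Fin N) ℂ)

/-- **Telescoping identity.** For a representation `ρ` and group elements `g₁, g₂, g₃, g₄`
(the four links of a plaquette, holonomy `g₁ g₂ g₃⁻¹ g₄⁻¹`) and colour vectors `w₀, w₁, w₁₂, w₂`
(the field at the four corners `x, x+μ̂, x+μ̂+ν̂, x+ν̂`):
`w₀ − ρ(g₁g₂g₃⁻¹g₄⁻¹) w₀ = (w₀ − ρ(g₁)w₁) + ρ(g₁)(w₁ − ρ(g₂)w₁₂) − ρ(g₁g₂g₃⁻¹)(w₂ − ρ(g₃)w₁₂)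
  − ρ(g₁g₂g₃⁻¹g₄⁻¹)(w₀ − ρ(g₄)w₂)`. [folklore] -/
theorem holonomy_defect_telescope (g₁ g₂ g₃ g₄ : G) (w₀ w₁ w₁₂ w₂ : Fin N → ℂ) :
    w₀ - ρ (g₁ * g₂ * g₃⁻¹ * g₄⁻¹) *ᵥ w₀ =
      (w₀ - ρ g₁ *ᵥ w₁) + ρ g₁ *ᵥ (w₁ - ρ g₂ *ᵥ w₁₂) +
        (-(ρ (g₁ * g₂ * g₃⁻¹) *ᵥ (w₂ - ρ g₃ *ᵥ w₁₂))) +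
        (-(ρ (g₁ * g₂ * g₃⁻¹ * g₄⁻¹) *ᵥ (w₀ - ρ g₄ *ᵥ w₂))) := by
  have hinv : ∀ (g : G) (u : Fin N → ℂ), ρ g⁻¹ *ᵥ (ρ g *ᵥ u) = u := fun g u => by
    rw [mulVec_mulVec, ← map_mul, inv_mul_cancel, map_one, one_mulVec]
  simp only [map_mul, mulVec_sub, ← mulVec_mulVec, hinv]
  abel

/-- **One-plaquette curvature bound.** For unitary `ρ`, with the notation of
`holonomy_defect_telescope`:
`Σ_a |w₀(a) − (ρ(g₁g₂g₃⁻¹g₄⁻¹)w₀)(a)|² ≤ 4 (|w₀ − ρ(g₁)w₁|² + |w₁ − ρ(g₂)w₁₂|² + |w₂ − ρ(g₃)w₁₂|²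
  + |w₀ − ρ(g₄)w₂|²)` (telescoping, `ρ(g)` isometric, `|Σ₄|² ≤ 4 Σ₄ |·|²`). [folklore] -/
theorem holonomy_defect_sq_le (hρ : ∀ g, ρ g ∈ Matrix.unitaryGroup (Fin N) ℂ)
    (g₁ g₂ g₃ g₄ : G) (w₀ w₁ w₁₂ w₂ : Fin N → ℂ) :
    ∑ a, ‖w₀ a - (ρ (g₁ * g₂ * g₃⁻¹ * g₄⁻¹) *ᵥ w₀) a‖ ^ 2 ≤
      4 * (∑ a, ‖w₀ a - (ρ g₁ *ᵥ w₁) a‖ ^ 2 + ∑ a, ‖w₁ a - (ρ g₂ *ᵥ w₁₂) a‖ ^ 2 +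
        ∑ a, ‖w₂ a - (ρ g₃ *ᵥ w₁₂) a‖ ^ 2 + ∑ a, ‖w₀ a - (ρ g₄ *ᵥ w₂) a‖ ^ 2) := by
  have hiso : ∀ (g : G) (u : Fin N → ℂ), ∑ a, ‖(ρ g *ᵥ u) a‖ ^ 2 = ∑ a, ‖u a‖ ^ 2 := fun g u =>
    sum_norm_sq_mulVec_of_isometry (ρ g) (Matrix.mem_unitaryGroup_iff'.mp (hρ g)) u
  have h := sum_norm_sq_add_four_le (w₀ - ρ g₁ *ᵥ w₁) (ρ g₁ *ᵥ (w₁ - ρ g₂ *ᵥ w₁₂))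
    (-(ρ (g₁ * g₂ * g₃⁻¹) *ᵥ (w₂ - ρ g₃ *ᵥ w₁₂)))
    (-(ρ (g₁ * g₂ * g₃⁻¹ * g₄⁻¹) *ᵥ (w₀ - ρ g₄ *ᵥ w₂)))
  rw [← holonomy_defect_telescope ρ g₁ g₂ g₃ g₄ w₀ w₁ w₁₂ w₂] at h
  simp only [Pi.neg_apply, norm_neg, hiso] at h
  simpa only [Pi.sub_apply] using h

end Plaquette

/-! ### The torus: kinetic identity and the sum over plaquettes -/

section Torus

variable {L N : ℕ} [NeZero L] {G : Type*} [Group G] (ρ : G →* Matrix (Fin N) (Fin N) ℂ)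

/-- **Lattice Weitzenböck bound (unitary `ρ`).** For every gauge field `U` on the four-torus and
every fermion field `v`:
`Σ_{x,μ,ν,α} Σ_a |v(x,a,α) − (ρ(U_□(x,μ,ν)) v(x,·,α))(a)|²
  ≤ 96 · Re Σ_i conj(v_i) (D_W(U,0,1) v)_i`.
Proof: the `μ = ν` holonomy is `1`; for `μ ≠ ν` the one-plaquette bound `holonomy_defect_sq_le`;
re-indexing the site sums by the torus translations `x ↦ x + μ̂`, every link defect
`Σ_α |D(y,κ)|²` is met `12` times, and `Σ_{y,κ,α} |D(y,κ)|² = 2 Re⟨v, D_W(U,0,1) v⟩` by the tree's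
`re_quadForm_wilsonDirac_eq_wilsonTerm`; `4 · 12 · 2 = 96`. [folklore] -/
theorem plaquetteDefect_le_quadForm_of_unitary (hρ : ∀ g, ρ g ∈ Matrix.unitaryGroup (Fin N) ℂ)
    (U : GaugeConfig 4 L G) (v : TorusSite 4 L × Fin N × Fin 4 → ℂ) :
    ∑ x : TorusSite 4 L, ∑ μ : Fin 4, ∑ ν : Fin 4, ∑ α : Fin 4, ∑ a : Fin N,
        ‖v (x, a, α) - (ρ (plaquetteHolonomy U x μ ν) *ᵥ (fun b => v (x, b, α))) a‖ ^ 2 ≤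
      96 * (∑ i, conj (v i) * (wilsonDirac ρ U 0 1 *ᵥ v) i).re := by
  -- link defects `T y κ α = |D(y,κ)|²` (spin `α`), their site/spin sums `S κ`,
  -- plaquette defects `d μ ν x α` and their site/spin sums `Q μ ν`
  set T : TorusSite 4 L → Fin 4 → Fin 4 → ℝ := fun y κ α =>
    ∑ a : Fin N, ‖v (y, a, α) - (ρ (U (y, κ)) *ᵥ fun b => v (Site.shift y κ, b, α)) a‖ ^ 2
    with hT
  set S : Fin 4 → ℝ := fun κ => ∑ y, ∑ α, T y κ α with hS
  set d : Fin 4 → Fin 4 → TorusSite 4 L → Fin 4 → ℝ := fun μ ν x α =>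
    ∑ a : Fin N, ‖v (x, a, α) - (ρ (plaquetteHolonomy U x μ ν) *ᵥ fun b => v (x, b, α)) a‖ ^ 2
    with hd
  set Q : Fin 4 → Fin 4 → ℝ := fun μ ν => ∑ x, ∑ α, d μ ν x α with hQ
  -- shifts commute on the torus
  have hshift : ∀ (x : TorusSite 4 L) (μ ν : Fin 4),
      Site.shift (Site.shift x ν) μ = Site.shift (Site.shift x μ) ν := fun x μ ν => by
    simp only [Literature.MathematicalPhysics.QuantumFieldTheory.Site.shift]
    abel
  -- one plaquette, one spin
  have hP : ∀ (μ ν : Fin 4) (x : TorusSite 4 L) (α : Fin 4), d μ ν x α ≤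
      4 * (T x μ α + T (Site.shift x μ) ν α + T (Site.shift x ν) μ α + T x ν α) := by
    intro μ ν x α
    have h := holonomy_defect_sq_le ρ hρ (U (x, μ)) (U (Site.shift x μ, ν))
      (U (Site.shift x ν, μ)) (U (x, ν)) (fun b => v (x, b, α))
      (fun b => v (Site.shift x μ, b, α)) (fun b => v (Site.shift (Site.shift x μ) ν, b, α))
      (fun b => v (Site.shift x ν, b, α))
    simp only [hd, hT]
    rw [hshift x μ ν]
    exact h
  -- torus translations
  have htr : ∀ (μ : Fin 4) (g : TorusSite 4 L → ℝ), ∑ x, g (Site.shift x μ) = ∑ x, g x :=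
    fun μ g => Fintype.sum_equiv (Equiv.addRight (Pi.single μ (1 : ZMod L))) _ _ fun _ => rfl
  -- one ordered pair of directions
  have hQle : ∀ μ ν : Fin 4, Q μ ν ≤ 8 * (S μ + S ν) := by
    intro μ ν
    have h1 : ∑ x, ∑ α, T (Site.shift x μ) ν α = S ν := htr μ (fun y => ∑ α, T y ν α)
    have h2 : ∑ x, ∑ α, T (Site.shift x ν) μ α = S μ := htr ν (fun y => ∑ α, T y μ α)
    calc Q μ ν ≤ ∑ x, ∑ α,
          4 * (T x μ α + T (Site.shift x μ) ν α + T (Site.shift x ν) μ α + T x ν α) :=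
          Finset.sum_le_sum fun x _ => Finset.sum_le_sum fun α _ => hP μ ν x α
      _ = 4 * (S μ + (∑ x, ∑ α, T (Site.shift x μ) ν α) + (∑ x, ∑ α, T (Site.shift x ν) μ α)
            + S ν) := by
          simp only [hS, Finset.mul_sum, Finset.sum_add_distrib, mul_add]
      _ = 8 * (S μ + S ν) := by rw [h1, h2]; ring
  -- the degenerate plaquettes
  have hQdiag : ∀ μ : Fin 4, Q μ μ = 0 := by
    intro μ
    refine Finset.sum_eq_zero fun x _ => Finset.sum_eq_zero fun α _ =>
      Finset.sum_eq_zero fun a _ => ?_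
    have h1 : plaquetteHolonomy U x μ μ = 1 := by simp [plaquetteHolonomy]
    simp [h1]
  -- the kinetic identity (Wilson-term accretivity at `m = 0`)
  have hkin : ∑ κ, S κ = 2 * (∑ i, conj (v i) * (wilsonDirac ρ U 0 1 *ᵥ v) i).re := by
    have hK : ∑ κ, S κ = ∑ x : TorusSite 4 L, ∑ μ : Fin 4, ∑ a : Fin N, ∑ α : Fin 4,
        ‖(∑ b : Fin N, ρ (U (x, μ)) a b * v (Site.shift x μ, b, α)) - v (x, a, α)‖ ^ 2 := by
      simp only [hS, hT]
      rw [Finset.sum_comm]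
      refine Finset.sum_congr rfl fun x _ => Finset.sum_congr rfl fun μ _ => ?_
      rw [Finset.sum_comm]
      refine Finset.sum_congr rfl fun a _ => Finset.sum_congr rfl fun α _ => ?_
      rw [norm_sub_rev]
      rfl
    have hW : (∑ i, conj (v i) * (wilsonDirac ρ U 0 1 *ᵥ v) i).re =
        0 * ∑ i, ‖v i‖ ^ 2 + (1 / 2 : ℝ) * ∑ x : TorusSite 4 L, ∑ μ : Fin 4, ∑ a : Fin N,
          ∑ α : Fin 4,
            ‖(∑ b : Fin N, ρ (U (x, μ)) a b * v (Site.shift x μ, b, α)) - v (x, a, α)‖ ^ 2 :=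
      re_quadForm_wilsonDirac_eq_wilsonTerm ρ hρ U 0 v
    rw [hK, hW]
    ring
  -- reorder the plaquette sum and expand the `16` ordered pairs of directions
  have hre : ∑ x, ∑ μ, ∑ ν, ∑ α, d μ ν x α = ∑ μ, ∑ ν, Q μ ν := by
    rw [Finset.sum_comm]
    refine Finset.sum_congr rfl fun μ _ => ?_
    rw [Finset.sum_comm]
  change ∑ x, ∑ μ, ∑ ν, ∑ α, d μ ν x α ≤ _
  rw [hre]
  simp only [Fin.sum_univ_four] at hkin ⊢
  linarith [hQle 0 1, hQle 0 2, hQle 0 3, hQle 1 0, hQle 1 2, hQle 1 3, hQle 2 0, hQle 2 1,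
    hQle 2 3, hQle 3 0, hQle 3 1, hQle 3 2, hQdiag 0, hQdiag 1, hQdiag 2, hQdiag 3]

end Torus

/-! ### The registered `SU(3)` statements -/

/-- **Lattice Weitzenböck bound (stub `plaquetteDefect_le_quadForm`).** For every `SU(3)` gauge
field `U` on the four-torus `(ℤ/L)⁴` and every quark field `v` (site × colour × spin), the
`v`-weighted plaquette defect is controlled by the real part of the Wilson–Dirac form at zero bare
mass: `Σ_{x,μ,ν,α} Σ_a |v(x,a,α) − (U_□(x,μ,ν) v(x,·,α))(a)|²
  ≤ 96 · Re Σ_i conj(v_i) (D_W(U,0,1) v)_i`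
(fundamental representation; `plaquetteDefect_le_quadForm_of_unitary`). [folklore] -/
theorem plaquetteDefect_le_quadForm {L : ℕ} [NeZero L] (U : GaugeConfig 4 L SU3)
    (v : TorusSite 4 L × Fin 3 × Fin 4 → ℂ) :
    ∑ x : TorusSite 4 L, ∑ μ : Fin 4, ∑ ν : Fin 4, ∑ α : Fin 4, ∑ a : Fin 3,
        ‖v (x, a, α) - ((fundamentalRep (Fin 3) (plaquetteHolonomy U x μ ν)) *ᵥ
          (fun b => v (x, b, α))) a‖ ^ 2 ≤
      96 * (∑ i, conj (v i) * (wilsonDirac (fundamentalRep (Fin 3)) U 0 1 *ᵥ v) i).re :=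
  plaquetteDefect_le_quadForm_of_unitary (fundamentalRep (Fin 3)) fundamentalRep_mem_unitaryGroup
    U v

/-- **Early real modes see an almost flat field (stub `plaquetteDefect_le_of_realEigenvalue`).**
If `D_W(U,0,1) v = λ v` with `λ` real, then
`Σ_{x,μ,ν,α} Σ_a |v(x,a,α) − (U_□(x,μ,ν) v(x,·,α))(a)|² ≤ 96 λ Σ_i |v_i|²`
(`plaquetteDefect_le_quadForm` and `Σ_i conj(v_i) (λ v)_i = λ Σ_i |v_i|²`). [folklore] -/
theorem plaquetteDefect_le_of_realEigenvalue {L : ℕ} [NeZero L] (U : GaugeConfig 4 L SU3)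
    (v : TorusSite 4 L × Fin 3 × Fin 4 → ℂ) (lam : ℝ)
    (hv : wilsonDirac (fundamentalRep (Fin 3)) U 0 1 *ᵥ v = ((lam : ℝ) : ℂ) • v) :
    ∑ x : TorusSite 4 L, ∑ μ : Fin 4, ∑ ν : Fin 4, ∑ α : Fin 4, ∑ a : Fin 3,
        ‖v (x, a, α) - ((fundamentalRep (Fin 3) (plaquetteHolonomy U x μ ν)) *ᵥ
          (fun b => v (x, b, α))) a‖ ^ 2 ≤ 96 * lam * ∑ i, ‖v i‖ ^ 2 := by
  have h := plaquetteDefect_le_quadForm U v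
  rw [hv] at h
  have hre : (∑ i, conj (v i) * ((((lam : ℝ) : ℂ) • v) i)).re = lam * ∑ i, ‖v i‖ ^ 2 := by
    rw [Complex.re_sum, Finset.mul_sum]
    refine Finset.sum_congr rfl fun i _ => ?_
    rw [Pi.smul_apply, smul_eq_mul, mul_left_comm, Complex.re_ofReal_mul, Complex.conj_mul',
      ← Complex.ofReal_pow, Complex.ofReal_re]
  rw [hre] at h
  calc _ ≤ 96 * (lam * ∑ i, ‖v i‖ ^ 2) := h
    _ = 96 * lam * ∑ i, ‖v i‖ ^ 2 := by ring

end Summit.QuantumFields.QCD.Cruxes.EarlyCrosserLaw.CurvatureBound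

end
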